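import Summits.QuantumFields.YangMills.Theorems.SwapVirialDeficitZeroModeThreeUpper
import HarnessLib

/-!
# The `k = 3` zero-mode block is REGULAR, V: the column integrals of the gap majorant (toward the power remainder `β^{-1/4}`)
# (free-hands support of crux ⟨stmt-QuantumFields-24197⟩ `SwapVirialDeficit.SwapGluedStiffness`, LINE «sharp-sigma»; companion of files I–IV-b)

Elementary Gaussian calculus on `ℝ³ = ℝ² × ℝ` and `(ℝ³)²`: §15 `∫_{ℝ³} g = ∫ dz ∫_{ℝ²} g(p,z) dp`, the slab–Gaussian column `∫ 𝟙{|z|≤1}e^{−c·plSq} = 2π/c`,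
the GAP COLUMN `∫ 𝟙{|z|≤1, 1 − plSq/(r⁴β) ≤ z²}e^{−plSq} ≤ 8π/(r⁴β)` (axial sliver of length `≤ 2ε`, then `t e^{−t} ≤ 2e^{−t/2}`); §16 two-column products,
the domination of the gap majorant `d_β` (file IV-b) by column products, ★★ `lintegral_dgap_le`: `∫ d_β(r,·) ≤ 32π²(3r⁻⁴ + r⁻²)/β`, ★ `lintegral_kup_le` (`≤ 4π²`).

HONEST LABEL: finite-dimensional calculus for a plan-level zero-mode rung of a DRAFT line; not the fixed-`L` sharp law, not ⟨24197⟩/⟨24194⟩, no rung / summit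
statement; the Yang–Mills mass gap is NOT proved; no summit is proved by a line.  Width seat ym-line-sfw-p2-w3 g62 (cell ym-idea-1, free hands),
`--supports stmt-QuantumFields-24197`.  Standard axioms, 0 `sorry`.  References: [folklore].
-/

set_option autoImplicit false

noncomputable section
namespace Summit.QuantumFields.YangMills.Theorems.ToronValleyVolume.ZeroMode

open MeasureTheory Real Finset Set Filter
open scoped ENNReal Topology
open Summit.QuantumFields.YangMills.Cruxes.ToronTubeVolumeLaw.Birth

/-! ## §15 One column: `ℝ³ = ℝ² × ℝ` -/

/-- Auxiliary: the last coordinate of `snoc p z`. [folklore] -/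
theorem snoc2_apply_two (p : Fin 2 → ℝ) (z : ℝ) : (Fin.snoc p z : Fin 3 → ℝ) 2 = z := Fin.snoc_last _ _

/-- Auxiliary: the first coordinate of `snoc p z`. [folklore] -/
theorem snoc2_apply_zero (p : Fin 2 → ℝ) (z : ℝ) : (Fin.snoc p z : Fin 3 → ℝ) 0 = p 0 := by
  rw [show (0 : Fin 3) = Fin.castSucc (0 : Fin 2) from rfl, Fin.snoc_castSucc]

/-- Auxiliary: the second coordinate of `snoc p z`. [folklore] -/
theorem snoc2_apply_one (p : Fin 2 → ℝ) (z : ℝ) : (Fin.snoc p z : Fin 3 → ℝ) 1 = p 1 := by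
  rw [show (1 : Fin 3) = Fin.castSucc (1 : Fin 2) from rfl, Fin.snoc_castSucc]

/-- `plSq` in the coordinates `(p, z)`: `plSq(p,z) = p₀² + p₁²`. [folklore] -/
theorem plSq_toLp_snoc (p : Fin 2 → ℝ) (z : ℝ) :
    plSq (WithLp.toLp 2 (Fin.snoc p z : Fin 3 → ℝ)) = p 0 ^ 2 + p 1 ^ 2 := by
  unfold plSq
  simp only [snoc2_apply_zero, snoc2_apply_one]

/-- FUBINI on `ℝ³ = ℝ × ℝ²`: `∫_{ℝ³} g = ∫ dz ∫_{ℝ²} g(p,z) dp` (lower integrals). [folklore] -/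
theorem lintegral_euclid3 (g : EuclideanSpace ℝ (Fin 3) → ℝ≥0∞) (hg : Measurable g) :
    ∫⁻ u, g u = ∫⁻ z : ℝ, ∫⁻ p : Fin 2 → ℝ, g (WithLp.toLp 2 (Fin.snoc p z)) := by
  have h1 := PiLp.volume_preserving_toLp (Fin 3)
  have hg1 : Measurable fun x : Fin 3 → ℝ => g (WithLp.toLp 2 x) := hg.comp (PiLp.continuous_toLp 2 _).measurable
  rw [← h1.lintegral_comp hg]
  have hp := (volume_preserving_piFinSuccAbove (fun _ : Fin 3 => ℝ) (Fin.last 2)).symm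
  rw [← hp.lintegral_comp hg1, Measure.volume_eq_prod, lintegral_prod]
  · refine lintegral_congr fun z => lintegral_congr fun p => ?_
    have h3 : ((MeasurableEquiv.piFinSuccAbove (fun _ : Fin 3 => ℝ) (Fin.last 2)).symm (z, p)) = Fin.snoc p z := by
      rw [MeasurableEquiv.piFinSuccAbove_symm_apply]; exact Fin.insertNth_last' z p
    rw [h3]
  · exact (hg1.comp (MeasurableEquiv.measurable _)).aemeasurable

/-- 1-D Gaussian as a lower integral: `∫ e^{−c x²} dx = √(π/c)` (`c > 0`). [folklore] -/
theorem lintegral_gauss (c : ℝ) (hc : 0 < c) :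
    ∫⁻ x : ℝ, ENNReal.ofReal (Real.exp (-c * x ^ 2)) = ENNReal.ofReal (Real.sqrt (Real.pi / c)) := by
  rw [← integral_gaussian, ofReal_integral_eq_lintegral_ofReal (integrable_exp_neg_mul_sq hc)
    (Filter.Eventually.of_forall fun x => (Real.exp_pos _).le)]

/-- Planar Gaussian: `∫_{ℝ²} e^{−c(p₀²+p₁²)} dp = π/c` (`c > 0`). [folklore] -/
theorem lintegral_planar_gauss (c : ℝ) (hc : 0 < c) :
    ∫⁻ p : Fin 2 → ℝ, ENNReal.ofReal (Real.exp (-(c * (p 0 ^ 2 + p 1 ^ 2)))) = ENNReal.ofReal (Real.pi / c) := by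
  have hm : Measurable fun x : ℝ => ENNReal.ofReal (Real.exp (-c * x ^ 2)) :=
    ENNReal.measurable_ofReal.comp (by fun_prop)
  have heq : ∀ p : Fin 2 → ℝ, ENNReal.ofReal (Real.exp (-(c * (p 0 ^ 2 + p 1 ^ 2)))) =
      ENNReal.ofReal (Real.exp (-c * (p 0) ^ 2)) * ENNReal.ofReal (Real.exp (-c * (p 1) ^ 2)) := by
    intro p
    rw [← ENNReal.ofReal_mul (Real.exp_pos _).le, ← Real.exp_add]; congr 1; ring
  simp_rw [heq]
  have h := volume_preserving_finTwoArrow ℝ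
  have hprod : ∫⁻ p : Fin 2 → ℝ, ENNReal.ofReal (Real.exp (-c * (p 0) ^ 2)) * ENNReal.ofReal (Real.exp (-c * (p 1) ^ 2))
      = (∫⁻ x : ℝ, ENNReal.ofReal (Real.exp (-c * x ^ 2))) * ∫⁻ x : ℝ, ENNReal.ofReal (Real.exp (-c * x ^ 2)) := by
    rw [← lintegral_prod_mul hm.aemeasurable hm.aemeasurable, ← Measure.volume_eq_prod,
      ← h.lintegral_comp (show Measurable (fun z : ℝ × ℝ =>
        ENNReal.ofReal (Real.exp (-c * z.1 ^ 2)) * ENNReal.ofReal (Real.exp (-c * z.2 ^ 2))) from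
          (hm.comp measurable_fst).mul (hm.comp measurable_snd))]
    rfl
  rw [hprod, lintegral_gauss c hc, ← ENNReal.ofReal_mul (Real.sqrt_nonneg _), Real.mul_self_sqrt (by positivity)]

/-- The one-column slab `|u₂| ≤ 1`. -/
def slab1 : Set (EuclideanSpace ℝ (Fin 3)) := {u | |u 2| ≤ 1}

/-- `slab1` is measurable. [folklore] -/
theorem measurableSet_slab1 : MeasurableSet slab1 :=
  measurableSet_le (continuous_abs.comp (EuclideanSpace.proj (2 : Fin 3)).continuous).measurable measurable_const

/-- The SLAB–GAUSSIAN COLUMN KERNEL `A_c(u) = 𝟙{|u₂| ≤ 1}·e^{−c·plSq(u)}`. -/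
def colA (c : ℝ) (u : EuclideanSpace ℝ (Fin 3)) : ℝ≥0∞ := slab1.indicator (fun u => ENNReal.ofReal (Real.exp (-(c * plSq u)))) u

/-- Auxiliary: `measurable_colA`. [folklore] -/
theorem measurable_colA (c : ℝ) : Measurable (colA c) := by
  refine Measurable.indicator (ENNReal.measurable_ofReal.comp ?_) measurableSet_slab1
  exact (by unfold plSq; fun_prop : Continuous fun u : EuclideanSpace ℝ (Fin 3) => Real.exp (-(c * plSq u))).measurable

/-- ★ `∫ A_c = 2π/c` (`c > 0`): the slab has axial length `2`, the planar Gaussian gives `π/c`. [folklore] -/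
theorem lintegral_colA (c : ℝ) (hc : 0 < c) : ∫⁻ u, colA c u = ENNReal.ofReal (2 * (Real.pi / c)) := by
  rw [lintegral_euclid3 _ (measurable_colA c)]
  have hin : ∀ (z : ℝ) (p : Fin 2 → ℝ), colA c (WithLp.toLp 2 (Fin.snoc p z)) =
      (Icc (-1 : ℝ) 1).indicator (fun _ => (1 : ℝ≥0∞)) z * ENNReal.ofReal (Real.exp (-(c * (p 0 ^ 2 + p 1 ^ 2)))) := by
    intro z p
    unfold colA
    have hmem : (WithLp.toLp 2 (Fin.snoc p z : Fin 3 → ℝ) : EuclideanSpace ℝ (Fin 3)) ∈ slab1 ↔ z ∈ Icc (-1 : ℝ) 1 := by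
      simp only [slab1, Set.mem_setOf_eq, snoc2_apply_two, Set.mem_Icc, abs_le]
    by_cases hz : z ∈ Icc (-1 : ℝ) 1
    · rw [indicator_of_mem (hmem.2 hz), indicator_of_mem hz, plSq_toLp_snoc, one_mul]
    · rw [indicator_of_notMem (fun h => hz (hmem.1 h)), indicator_of_notMem hz, zero_mul]
  simp_rw [hin]
  have hm : Measurable fun p : Fin 2 → ℝ => ENNReal.ofReal (Real.exp (-(c * (p 0 ^ 2 + p 1 ^ 2)))) :=
    ENNReal.measurable_ofReal.comp (by fun_prop)
  simp_rw [lintegral_const_mul _ hm, lintegral_planar_gauss c hc]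
  rw [lintegral_mul_const _ (measurable_const.indicator measurableSet_Icc), lintegral_indicator measurableSet_Icc,
    setLIntegral_const, one_mul, Real.volume_Icc, ← ENNReal.ofReal_mul (by norm_num)]
  congr 1; ring

/-- The GAP COLUMN set `|u₂| ≤ 1 ∧ 1 − plSq(u)/(r⁴β) ≤ u₂²`. -/
def gapSet (β r : ℝ) : Set (EuclideanSpace ℝ (Fin 3)) := {u | |u 2| ≤ 1 ∧ 1 - plSq u / (r ^ 4 * β) ≤ (u 2) ^ 2}

/-- `gapSet` is measurable. [folklore] -/
theorem measurableSet_gapSet (β r : ℝ) : MeasurableSet (gapSet β r) := by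
  have h2 : Continuous fun u : EuclideanSpace ℝ (Fin 3) => u 2 := (EuclideanSpace.proj (2 : Fin 3)).continuous
  refine (measurableSet_le (continuous_abs.comp h2).measurable measurable_const).inter
    (measurableSet_le ?_ (h2.pow 2).measurable)
  exact (continuous_const.sub (continuous_plSq.div_const _)).measurable

/-- The GAP COLUMN KERNEL `C_{β,r}(u) = 𝟙_{gapSet}(u)·e^{−plSq(u)}`. -/
def colC (β r : ℝ) (u : EuclideanSpace ℝ (Fin 3)) : ℝ≥0∞ := (gapSet β r).indicator (fun u => ENNReal.ofReal (Real.exp (-plSq u))) u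

/-- Auxiliary: `measurable_colC`. [folklore] -/
theorem measurable_colC (β r : ℝ) : Measurable (colC β r) :=
  (ENNReal.measurable_ofReal.comp (Real.continuous_exp.comp continuous_plSq.neg).measurable).indicator
    (measurableSet_gapSet β r)

/-- The axial SLIVER `{z : |z| ≤ 1, 1 − ε ≤ z²}` has length `≤ 2ε` (`ε ≥ 0`). [folklore] -/
theorem volume_sliver_le {ε : ℝ} (hε : 0 ≤ ε) : volume {z : ℝ | |z| ≤ 1 ∧ 1 - ε ≤ z ^ 2} ≤ ENNReal.ofReal (2 * ε) := by
  have hsub : {z : ℝ | |z| ≤ 1 ∧ 1 - ε ≤ z ^ 2} ⊆ Icc (-1) (-(1 - ε)) ∪ Icc (1 - ε) 1 := by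
    intro z ⟨h1, h2⟩
    rw [abs_le] at h1
    by_cases hz : 0 ≤ z
    · right; exact ⟨by nlinarith, h1.2⟩
    · left; push Not at hz; exact ⟨h1.1, by nlinarith⟩
  calc volume {z : ℝ | |z| ≤ 1 ∧ 1 - ε ≤ z ^ 2} ≤ volume (Icc (-1 : ℝ) (-(1 - ε)) ∪ Icc (1 - ε) 1) := measure_mono hsub
    _ ≤ volume (Icc (-1 : ℝ) (-(1 - ε))) + volume (Icc (1 - ε) (1 : ℝ)) := measure_union_le _ _
    _ = ENNReal.ofReal (2 * ε) := by
        rw [Real.volume_Icc, Real.volume_Icc, ← ENNReal.ofReal_add (by linarith) (by linarith)]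
        congr 1; ring

/-- `t·e^{−t} ≤ 2·e^{−t/2}` (all real `t`; from `e^{s} ≥ 1 + s`). [folklore] -/
theorem mul_exp_neg_le_two_exp_neg_half (t : ℝ) : t * Real.exp (-t) ≤ 2 * Real.exp (-(t / 2)) := by
  have h1 : t / 2 ≤ Real.exp (t / 2) := by linarith [Real.add_one_le_exp (t / 2)]
  have h2 : Real.exp (-t) = Real.exp (-(t / 2)) * Real.exp (-(t / 2)) := by rw [← Real.exp_add]; congr 1; ring
  have h3 : Real.exp (t / 2) * Real.exp (-(t / 2)) = 1 := by rw [← Real.exp_add]; simp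
  rw [h2]
  nlinarith [Real.exp_pos (-(t / 2)), Real.exp_pos (t / 2), h1, h3]

/-- ★ THE GAP COLUMN: `∫ C_{β,r} ≤ 8π/(r⁴β)` (`r, β > 0`). [folklore] -/
theorem lintegral_colC_le {β r : ℝ} (hβ : 0 < β) (hr : 0 < r) :
    ∫⁻ u, colC β r u ≤ ENNReal.ofReal (8 * Real.pi / (r ^ 4 * β)) := by
  have hr4β : 0 < r ^ 4 * β := by positivity
  rw [lintegral_euclid3 _ (measurable_colC β r)]
  -- the integrand in coordinates
  set S : Set (ℝ × (Fin 2 → ℝ)) := {q | |q.1| ≤ 1 ∧ 1 - (q.2 0 ^ 2 + q.2 1 ^ 2) / (r ^ 4 * β) ≤ q.1 ^ 2} with hS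
  have hSm : MeasurableSet S := by
    have m1 : Measurable fun q : ℝ × (Fin 2 → ℝ) => |q.1| := by fun_prop
    have m2 : Measurable fun q : ℝ × (Fin 2 → ℝ) => 1 - (q.2 0 ^ 2 + q.2 1 ^ 2) / (r ^ 4 * β) := by fun_prop
    have m3 : Measurable fun q : ℝ × (Fin 2 → ℝ) => q.1 ^ 2 := by fun_prop
    rw [hS]
    exact (measurableSet_le m1 measurable_const).inter (measurableSet_le m2 m3)
  set G : ℝ × (Fin 2 → ℝ) → ℝ≥0∞ := fun q =>
    S.indicator (fun q => ENNReal.ofReal (Real.exp (-(q.2 0 ^ 2 + q.2 1 ^ 2)))) q with hG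
  have hGm : Measurable G :=
    (ENNReal.measurable_ofReal.comp (by fun_prop : Continuous fun q : ℝ × (Fin 2 → ℝ) =>
      Real.exp (-(q.2 0 ^ 2 + q.2 1 ^ 2))).measurable).indicator hSm
  have hin : ∀ (z : ℝ) (p : Fin 2 → ℝ), colC β r (WithLp.toLp 2 (Fin.snoc p z)) = G (z, p) := by
    intro z p
    unfold colC; rw [hG]
    have hmem : (WithLp.toLp 2 (Fin.snoc p z : Fin 3 → ℝ) : EuclideanSpace ℝ (Fin 3)) ∈ gapSet β r ↔ (z, p) ∈ S := by
      simp only [gapSet, hS, Set.mem_setOf_eq, snoc2_apply_two, plSq_toLp_snoc]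
    by_cases hz : (z, p) ∈ S
    · simp only [indicator_of_mem (hmem.2 hz), indicator_of_mem hz, plSq_toLp_snoc]
    · simp only [indicator_of_notMem (fun h => hz (hmem.1 h)), indicator_of_notMem hz]
  simp_rw [hin]
  -- swap the order: planar outside, axial inside
  rw [lintegral_lintegral_swap hGm.aemeasurable]
  -- inner axial integral: the sliver
  have hinner : ∀ p : Fin 2 → ℝ, ∫⁻ z, G (z, p) ≤
      ENNReal.ofReal (Real.exp (-(p 0 ^ 2 + p 1 ^ 2)) * (2 * ((p 0 ^ 2 + p 1 ^ 2) / (r ^ 4 * β)))) := by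
    intro p
    have hε : 0 ≤ (p 0 ^ 2 + p 1 ^ 2) / (r ^ 4 * β) := by positivity
    have hGz : ∀ z, G (z, p) = {z : ℝ | |z| ≤ 1 ∧ 1 - (p 0 ^ 2 + p 1 ^ 2) / (r ^ 4 * β) ≤ z ^ 2}.indicator
        (fun _ => ENNReal.ofReal (Real.exp (-(p 0 ^ 2 + p 1 ^ 2)))) z := by
      intro z
      show S.indicator (fun q => ENNReal.ofReal (Real.exp (-(q.2 0 ^ 2 + q.2 1 ^ 2)))) (z, p) = _
      by_cases hz : (z, p) ∈ S
      · rw [indicator_of_mem hz, indicator_of_mem (show z ∈ {z : ℝ | |z| ≤ 1 ∧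
          1 - (p 0 ^ 2 + p 1 ^ 2) / (r ^ 4 * β) ≤ z ^ 2} from hz)]
      · rw [indicator_of_notMem hz, indicator_of_notMem (show z ∉ {z : ℝ | |z| ≤ 1 ∧
          1 - (p 0 ^ 2 + p 1 ^ 2) / (r ^ 4 * β) ≤ z ^ 2} from hz)]
    have hset : MeasurableSet {z : ℝ | |z| ≤ 1 ∧ 1 - (p 0 ^ 2 + p 1 ^ 2) / (r ^ 4 * β) ≤ z ^ 2} :=
      (measurableSet_le continuous_abs.measurable measurable_const).inter
        (measurableSet_le measurable_const (measurable_id.pow_const 2))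
    simp_rw [hGz]
    rw [lintegral_indicator hset, setLIntegral_const, ENNReal.ofReal_mul (Real.exp_pos _).le]
    gcongr
    exact volume_sliver_le hε
  -- then the planar Gaussian moment, via `t e^{−t} ≤ 2 e^{−t/2}`
  have hpl : ∀ p : Fin 2 → ℝ, ENNReal.ofReal (Real.exp (-(p 0 ^ 2 + p 1 ^ 2)) * (2 * ((p 0 ^ 2 + p 1 ^ 2) / (r ^ 4 * β))))
      ≤ ENNReal.ofReal (4 / (r ^ 4 * β)) * ENNReal.ofReal (Real.exp (-((1 / 2) * (p 0 ^ 2 + p 1 ^ 2)))) := by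
    intro p
    rw [← ENNReal.ofReal_mul (by positivity)]
    refine ENNReal.ofReal_le_ofReal ?_
    have h := mul_exp_neg_le_two_exp_neg_half (p 0 ^ 2 + p 1 ^ 2)
    rw [show -((1 / 2) * (p 0 ^ 2 + p 1 ^ 2)) = -((p 0 ^ 2 + p 1 ^ 2) / 2) by ring]
    rw [show Real.exp (-(p 0 ^ 2 + p 1 ^ 2)) * (2 * ((p 0 ^ 2 + p 1 ^ 2) / (r ^ 4 * β)))
        = (2 / (r ^ 4 * β)) * ((p 0 ^ 2 + p 1 ^ 2) * Real.exp (-(p 0 ^ 2 + p 1 ^ 2))) by ring]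
    rw [show 4 / (r ^ 4 * β) * Real.exp (-((p 0 ^ 2 + p 1 ^ 2) / 2))
        = (2 / (r ^ 4 * β)) * (2 * Real.exp (-((p 0 ^ 2 + p 1 ^ 2) / 2))) by ring]
    exact mul_le_mul_of_nonneg_left h (by positivity)
  have hm2 : Measurable fun p : Fin 2 → ℝ => ENNReal.ofReal (Real.exp (-((1 / 2) * (p 0 ^ 2 + p 1 ^ 2)))) :=
    ENNReal.measurable_ofReal.comp (by fun_prop)
  calc ∫⁻ p : Fin 2 → ℝ, ∫⁻ z, G (z, p)
      ≤ ∫⁻ p : Fin 2 → ℝ, ENNReal.ofReal (4 / (r ^ 4 * β)) * ENNReal.ofReal (Real.exp (-((1 / 2) * (p 0 ^ 2 + p 1 ^ 2)))) :=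
        lintegral_mono fun p => (hinner p).trans (hpl p)
    _ = ENNReal.ofReal (4 / (r ^ 4 * β)) * ENNReal.ofReal (Real.pi / (1 / 2)) := by
        rw [lintegral_const_mul _ hm2, lintegral_planar_gauss (1 / 2) (by norm_num)]
    _ = ENNReal.ofReal (8 * Real.pi / (r ^ 4 * β)) := by
        rw [← ENNReal.ofReal_mul (by positivity)]; congr 1; field_simp; ring

/-! ## §16 Two columns: products and the integrals of `d_β`, `k_∞` -/

/-- PRODUCT INTEGRALS over the two columns: `∫_{(ℝ³)²} f(y₀)·g(y₁) dy = ∫f · ∫g`. [folklore] -/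
theorem lintegral_two_columns (f g : EuclideanSpace ℝ (Fin 3) → ℝ≥0∞) (hf : Measurable f) (hg : Measurable g) :
    ∫⁻ y : Fin 2 → EuclideanSpace ℝ (Fin 3), f (y 0) * g (y 1) = (∫⁻ u, f u) * ∫⁻ u, g u := by
  have h := volume_preserving_finTwoArrow (EuclideanSpace ℝ (Fin 3))
  rw [← lintegral_prod_mul hf.aemeasurable hg.aemeasurable, ← Measure.volume_eq_prod,
    ← h.lintegral_comp (by fun_prop : Measurable fun z : EuclideanSpace ℝ (Fin 3) × EuclideanSpace ℝ (Fin 3) =>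
      f z.1 * g z.2)]
  rfl

/-- `A_1 ≤ A_{1/2}` pointwise. [folklore] -/
theorem colA_one_le_half (u : EuclideanSpace ℝ (Fin 3)) : colA 1 u ≤ colA (1 / 2) u := by
  unfold colA
  by_cases hu : u ∈ slab1
  · rw [indicator_of_mem hu, indicator_of_mem hu]
    exact ENNReal.ofReal_le_ofReal (Real.exp_le_exp.2 (by nlinarith [plSq_nonneg u]))
  · rw [indicator_of_notMem hu, indicator_of_notMem hu]

/-- ★ POINTWISE DOMINATION of the gap majorant by column products:
`d_β ≤ (4/(r⁴β) + 2/(r²β))·A_{1/2}(y₀)A_{1/2}(y₁) + C(y₀)A_1(y₁) + A_1(y₀)C(y₁)`. [folklore] -/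
theorem dgap_le_columns {β r : ℝ} (hβ : 0 < β) (hr : 0 < r) (y : Fin 2 → EuclideanSpace ℝ (Fin 3)) :
    dgap β r y ≤ ENNReal.ofReal (4 / (r ^ 4 * β) + 2 / (r ^ 2 * β)) * (colA (1 / 2) (y 0) * colA (1 / 2) (y 1))
      + (colC β r (y 0) * colA 1 (y 1) + colA 1 (y 0) * colC β r (y 1)) := by
  unfold dgap
  by_cases hy : y ∈ slab2
  swap
  · rw [indicator_of_notMem hy]; exact zero_le
  rw [indicator_of_mem hy]
  have h0 : y 0 ∈ slab1 := hy 0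
  have h1 : y 1 ∈ slab1 := hy 1
  have hP0 := plSq_nonneg (y 0); have hP1 := plSq_nonneg (y 1)
  have hr4β : 0 < r ^ 4 * β := by positivity
  have hr2β : 0 < r ^ 2 * β := by positivity
  -- real bounds for the three terms
  have hA : Real.exp (-(plSq (y 0) + plSq (y 1))) * (plSq (y 0) * plSq (y 1) / r ^ 4) / β
      ≤ 4 / (r ^ 4 * β) * (Real.exp (-(1 / 2 * plSq (y 0))) * Real.exp (-(1 / 2 * plSq (y 1)))) := by
    have e0 := mul_exp_neg_le_two_exp_neg_half (plSq (y 0))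
    have e1 := mul_exp_neg_le_two_exp_neg_half (plSq (y 1))
    rw [show -(plSq (y 0) + plSq (y 1)) = -plSq (y 0) + -plSq (y 1) by ring, Real.exp_add,
      show -(1 / 2 * plSq (y 0)) = -(plSq (y 0) / 2) by ring, show -(1 / 2 * plSq (y 1)) = -(plSq (y 1) / 2) by ring]
    rw [show Real.exp (-plSq (y 0)) * Real.exp (-plSq (y 1)) * (plSq (y 0) * plSq (y 1) / r ^ 4) / β
        = (1 / (r ^ 4 * β)) * ((plSq (y 0) * Real.exp (-plSq (y 0))) * (plSq (y 1) * Real.exp (-plSq (y 1)))) by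
      field_simp]
    rw [show 4 / (r ^ 4 * β) * (Real.exp (-(plSq (y 0) / 2)) * Real.exp (-(plSq (y 1) / 2)))
        = (1 / (r ^ 4 * β)) * ((2 * Real.exp (-(plSq (y 0) / 2))) * (2 * Real.exp (-(plSq (y 1) / 2)))) by ring]
    refine mul_le_mul_of_nonneg_left ?_ (by positivity)
    exact mul_le_mul e0 e1 (by positivity) (by positivity)
  have hB : Real.exp (-(plSq (y 0) + plSq (y 1))) * ((plSq (y 0) + plSq (y 1)) / (2 * r ^ 2)) / β
      ≤ 2 / (r ^ 2 * β) * (Real.exp (-(1 / 2 * plSq (y 0))) * Real.exp (-(1 / 2 * plSq (y 1)))) := by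
    have e := mul_exp_neg_le_two_exp_neg_half (plSq (y 0) + plSq (y 1))
    rw [show -(1 / 2 * plSq (y 0)) = -(plSq (y 0) / 2) by ring, show -(1 / 2 * plSq (y 1)) = -(plSq (y 1) / 2) by ring,
      ← Real.exp_add, show -(plSq (y 0) / 2) + -(plSq (y 1) / 2) = -((plSq (y 0) + plSq (y 1)) / 2) by ring]
    rw [show Real.exp (-(plSq (y 0) + plSq (y 1))) * ((plSq (y 0) + plSq (y 1)) / (2 * r ^ 2)) / β
        = (1 / (2 * r ^ 2 * β)) * ((plSq (y 0) + plSq (y 1)) * Real.exp (-(plSq (y 0) + plSq (y 1)))) by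
      field_simp]
    rw [show 2 / (r ^ 2 * β) * Real.exp (-((plSq (y 0) + plSq (y 1)) / 2))
        = (1 / (2 * r ^ 2 * β)) * (2 * (2 * Real.exp (-((plSq (y 0) + plSq (y 1)) / 2)))) by field_simp]
    refine mul_le_mul_of_nonneg_left (e.trans ?_) (by positivity)
    linarith [Real.exp_pos (-((plSq (y 0) + plSq (y 1)) / 2))]
  -- the ENNReal column values on the slab
  have hcA : ∀ μ : Fin 2, y μ ∈ slab1 → colA (1 / 2) (y μ) = ENNReal.ofReal (Real.exp (-(1 / 2 * plSq (y μ)))) :=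
    fun μ hμ => by unfold colA; rw [indicator_of_mem hμ]
  have hcA1 : ∀ μ : Fin 2, y μ ∈ slab1 → colA 1 (y μ) = ENNReal.ofReal (Real.exp (-plSq (y μ))) :=
    fun μ hμ => by unfold colA; rw [indicator_of_mem hμ, one_mul]
  have hcC : ∀ μ : Fin 2, y μ ∈ slab1 → colC β r (y μ) =
      ENNReal.ofReal (if 1 - plSq (y μ) / (r ^ 4 * β) ≤ (y μ 2) ^ 2 then Real.exp (-plSq (y μ)) else 0) := by
    intro μ hμ
    unfold colC
    by_cases hc : 1 - plSq (y μ) / (r ^ 4 * β) ≤ (y μ 2) ^ 2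
    · rw [indicator_of_mem (show y μ ∈ gapSet β r from ⟨hμ, hc⟩), if_pos hc]
    · rw [indicator_of_notMem (fun h => hc h.2), if_neg hc, ENNReal.ofReal_zero]
  rw [hcA 0 h0, hcA 1 h1, hcA1 0 h0, hcA1 1 h1, hcC 0 h0, hcC 1 h1]
  -- everything is `ofReal` of nonnegative reals: compare in `ℝ`
  have hi0 : 0 ≤ (if 1 - plSq (y 0) / (r ^ 4 * β) ≤ (y 0 2) ^ 2 then Real.exp (-plSq (y 0)) else 0) := by
    split_ifs
    · exact (Real.exp_pos _).le
    · exact le_rfl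
  have hi1 : 0 ≤ (if 1 - plSq (y 1) / (r ^ 4 * β) ≤ (y 1 2) ^ 2 then Real.exp (-plSq (y 1)) else 0) := by
    split_ifs
    · exact (Real.exp_pos _).le
    · exact le_rfl
  rw [← ENNReal.ofReal_mul (Real.exp_pos _).le, ← ENNReal.ofReal_mul (by positivity), ← ENNReal.ofReal_mul hi0,
    ← ENNReal.ofReal_mul (Real.exp_pos _).le, ← ENNReal.ofReal_add (mul_nonneg hi0 (Real.exp_pos _).le)
      (mul_nonneg (Real.exp_pos _).le hi1), ← ENNReal.ofReal_add (by positivity) (by positivity)]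
  refine ENNReal.ofReal_le_ofReal ?_
  have hC0 : Real.exp (-(plSq (y 0) + plSq (y 1))) * (if 1 - plSq (y 0) / (r ^ 4 * β) ≤ (y 0 2) ^ 2 then (1:ℝ) else 0)
      ≤ (if 1 - plSq (y 0) / (r ^ 4 * β) ≤ (y 0 2) ^ 2 then Real.exp (-plSq (y 0)) else 0) * Real.exp (-plSq (y 1)) := by
    split_ifs
    · rw [show -(plSq (y 0) + plSq (y 1)) = -plSq (y 0) + -plSq (y 1) by ring, Real.exp_add, mul_one]
    · rw [mul_zero, zero_mul]
  have hC1 : Real.exp (-(plSq (y 0) + plSq (y 1))) * (if 1 - plSq (y 1) / (r ^ 4 * β) ≤ (y 1 2) ^ 2 then (1:ℝ) else 0)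
      ≤ Real.exp (-plSq (y 0)) * (if 1 - plSq (y 1) / (r ^ 4 * β) ≤ (y 1 2) ^ 2 then Real.exp (-plSq (y 1)) else 0) := by
    split_ifs
    · rw [show -(plSq (y 0) + plSq (y 1)) = -plSq (y 0) + -plSq (y 1) by ring, Real.exp_add, mul_one]
    · rw [mul_zero, mul_zero]
  have hexp : dgapR β r y =
      Real.exp (-(plSq (y 0) + plSq (y 1))) * (plSq (y 0) * plSq (y 1) / r ^ 4) / β
      + Real.exp (-(plSq (y 0) + plSq (y 1))) * ((plSq (y 0) + plSq (y 1)) / (2 * r ^ 2)) / β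
      + Real.exp (-(plSq (y 0) + plSq (y 1))) * (if 1 - plSq (y 0) / (r ^ 4 * β) ≤ (y 0 2) ^ 2 then (1:ℝ) else 0)
      + Real.exp (-(plSq (y 0) + plSq (y 1))) * (if 1 - plSq (y 1) / (r ^ 4 * β) ≤ (y 1 2) ^ 2 then (1:ℝ) else 0) := by
    unfold dgapR; rw [Fin.sum_univ_two]; ring
  rw [hexp]
  linarith [hA, hB, hC0, hC1]

/-- ★★ **THE GAP INTEGRAL**: `∫ d_β(r,·) ≤ 32π²·(3r⁻⁴ + r⁻²)/β` (`r, β > 0`). [folklore] -/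
theorem lintegral_dgap_le {β r : ℝ} (hβ : 0 < β) (hr : 0 < r) :
    ∫⁻ y, dgap β r y ≤ ENNReal.ofReal (32 * Real.pi ^ 2 * (3 / r ^ 4 + 1 / r ^ 2) / β) := by
  have hr4β : 0 < r ^ 4 * β := by positivity
  have hr2β : 0 < r ^ 2 * β := by positivity
  have hA := lintegral_colA (1 / 2) (by norm_num)
  have hA1 := lintegral_colA 1 one_pos
  have hC := lintegral_colC_le hβ hr
  have hm := measurable_colA (1 / 2)
  have hm1 := measurable_colA 1
  have hmC := measurable_colC β r
  calc ∫⁻ y, dgap β r y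
      ≤ ∫⁻ y : Fin 2 → EuclideanSpace ℝ (Fin 3), (ENNReal.ofReal (4 / (r ^ 4 * β) + 2 / (r ^ 2 * β)) *
          (colA (1 / 2) (y 0) * colA (1 / 2) (y 1)) + (colC β r (y 0) * colA 1 (y 1) + colA 1 (y 0) * colC β r (y 1))) :=
        lintegral_mono fun y => dgap_le_columns hβ hr y
    _ = ENNReal.ofReal (4 / (r ^ 4 * β) + 2 / (r ^ 2 * β)) * ((∫⁻ u, colA (1 / 2) u) * ∫⁻ u, colA (1 / 2) u)
          + ((∫⁻ u, colC β r u) * (∫⁻ u, colA 1 u) + (∫⁻ u, colA 1 u) * ∫⁻ u, colC β r u) := by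
        have m0 : Measurable fun y : Fin 2 → EuclideanSpace ℝ (Fin 3) => colA (1 / 2) (y 0) * colA (1 / 2) (y 1) :=
          (hm.comp (measurable_pi_apply 0)).mul (hm.comp (measurable_pi_apply 1))
        have m1 : Measurable fun y : Fin 2 → EuclideanSpace ℝ (Fin 3) =>
            ENNReal.ofReal (4 / (r ^ 4 * β) + 2 / (r ^ 2 * β)) * (colA (1 / 2) (y 0) * colA (1 / 2) (y 1)) :=
          m0.const_mul _
        have m2 : Measurable fun y : Fin 2 → EuclideanSpace ℝ (Fin 3) => colC β r (y 0) * colA 1 (y 1) :=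
          (hmC.comp (measurable_pi_apply 0)).mul (hm1.comp (measurable_pi_apply 1))
        rw [lintegral_add_left m1, lintegral_add_left m2, lintegral_const_mul _ m0,
          lintegral_two_columns _ _ hm hm, lintegral_two_columns _ _ hmC hm1, lintegral_two_columns _ _ hm1 hmC]
    _ ≤ ENNReal.ofReal (4 / (r ^ 4 * β) + 2 / (r ^ 2 * β)) * (ENNReal.ofReal (2 * (Real.pi / (1 / 2))) *
          ENNReal.ofReal (2 * (Real.pi / (1 / 2))))
          + (ENNReal.ofReal (8 * Real.pi / (r ^ 4 * β)) * ENNReal.ofReal (2 * (Real.pi / 1))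
            + ENNReal.ofReal (2 * (Real.pi / 1)) * ENNReal.ofReal (8 * Real.pi / (r ^ 4 * β))) := by
        rw [hA, hA1]; gcongr
    _ = ENNReal.ofReal (32 * Real.pi ^ 2 * (3 / r ^ 4 + 1 / r ^ 2) / β) := by
        rw [← ENNReal.ofReal_mul (by positivity), ← ENNReal.ofReal_mul (by positivity),
          ← ENNReal.ofReal_mul (by positivity), ← ENNReal.ofReal_mul (by positivity),
          ← ENNReal.ofReal_add (by positivity) (by positivity), ← ENNReal.ofReal_add (by positivity) (by positivity)]
        congr 1
        field_simp
        ring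

/-- `k_∞ ≤ A_1(y₀)·A_1(y₁)` pointwise (drop the cross term and the axial Gaussian). [folklore] -/
theorem kup_le_colA (r : ℝ) (y : Fin 2 → EuclideanSpace ℝ (Fin 3)) : kup r y ≤ colA 1 (y 0) * colA 1 (y 1) := by
  unfold kup colA
  by_cases hy : y ∈ slab2
  · rw [indicator_of_mem hy, indicator_of_mem (show y 0 ∈ slab1 from hy 0), indicator_of_mem (show y 1 ∈ slab1 from hy 1),
      ← ENNReal.ofReal_mul (Real.exp_pos _).le, ← Real.exp_add]
    refine ENNReal.ofReal_le_ofReal (Real.exp_le_exp.2 ?_)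
    have h1 := cr_nonneg (y 0) (y 1)
    have h2 : 0 ≤ r ^ 2 * ((y 0 2) ^ 2 + (y 1 2) ^ 2) := by positivity
    linarith
  · rw [indicator_of_notMem hy]; exact zero_le

/-- ★ `∫ k_∞(r,·) ≤ 4π²`. [folklore] -/
theorem lintegral_kup_le (r : ℝ) : ∫⁻ y, kup r y ≤ ENNReal.ofReal (4 * Real.pi ^ 2) := by
  calc ∫⁻ y, kup r y ≤ ∫⁻ y : Fin 2 → EuclideanSpace ℝ (Fin 3), colA 1 (y 0) * colA 1 (y 1) :=
        lintegral_mono fun y => kup_le_colA r y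
    _ = (∫⁻ u, colA 1 u) * ∫⁻ u, colA 1 u := lintegral_two_columns _ _ (measurable_colA 1) (measurable_colA 1)
    _ = ENNReal.ofReal (4 * Real.pi ^ 2) := by
        rw [lintegral_colA 1 one_pos, ← ENNReal.ofReal_mul (by positivity)]; congr 1; ring

end Summit.QuantumFields.YangMills.Theorems.ToronValleyVolume.ZeroMode

end
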